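/-
Copyright: public-audit package `pub-balaban` (b2b-balaban), seat pv09-g6. Released under Apache 2.0 like Mathlib.
-/
import Mathlib
import Literature.MathematicalPhysics.QuantumFieldTheory.Balaban1983to89.B5Kernel166Decay
import Literature.MathematicalPhysics.QuantumFieldTheory.Balaban1983to89.B6Cov2156TorusSubset

/-!
# B6 (2.156) on every Λ = B(Λ′₀) ⊂ T^(k) for the (1.66) form — the decay of C^{(k)}_Λ with NO residual hypothesis
(by-name fold of `B6Cov2156TorusSubset` with `B5Kernel166Decay.kernelDecay166`)

Source under audit: T. Bałaban, *Propagators and renormalization transformations for lattice gauge theories. II*,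
Commun. Math. Phys. **96** (1984) 223–250 [B6, `Balaban1984PropagatorsII`], (2.152)–(2.157) pp. 249–250; with
*… I*, Commun. Math. Phys. **95** (1984) 17–40 [B5, `Balaban1984PropagatorsI`], (1.66) p. 29.  Quotations below were
read by this seat from the ×2 page renders `run/shared/lean/pub/pub-balaban/b2b-balaban-ref1/pages/
1984-cmp96-propagators-rt-II/…-p027-x2.png` (p. 249) and `…-p028-x2.png` (p. 250) (journal page = PDF page + 222),
read as images, not from an OCR layer.

CITATION HEADER (lean-in-tree rule).  Cell `pub-balaban`, unit `b2b-balaban-pv09-g6` (surge node prover #09, gen 6;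
journal claim G-B6-2156-SUBSET-166, self-assigned under the yield clause on the explicit hand-over of unit
`b2b-balaban-b05-g9`, journal NOTE 2026-08-19T07:19:47Z: the whole-torus fold is theirs
(`B5Kernel166Decay.cov2156_torus_166`), the Λ ⊂ T^(k) fold is this lineage's by the one-writer rule).  Siblings
imported, none edited: `…B5Kernel166Decay` (b05-g9, p184553: **`kernelDecay166`** — the decay of the kernel of THE
matrix `B6Cov2156Torus.deltaPol M n` of the (1.66) form on the torus, constants depending on d only, PROVED from the
strip analyticity of the (1.66) symbol, `B5Symbol166Strip`), `…B6Cov2156TorusSubset` (this unit, p184144: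
`cov2156_torusS` / `cov2156_torus_subset_deltaPol` — (2.152)–(2.157) for every sub-family C_S of the torus scheme and
for C_Λ, Λ = B(Λ′₀), the decay of Δ_k the ONLY hypothesis), through it `…B6Cov2156Torus` (this unit, p183510/p184063:
`elimT`, `freeT`, `deltaPol`, `KernelDecay`, `Represents`, (2.153)_T discharged `lowerOnConstrainedT_of_represents`).

## What is printed (verbatim, p. 250, after (2.156))

«By the definition of C we have of course that CB′ = 0 outside Λ, QCB′ = 0, (CB′)(Γ_{y,x}) = 0, x ∈ B(y), y ∈ Λ′, for
arbitrary B′. The inequality (2.153) implies ⟨B′, C*Δ_kCB′⟩ ≥ (γ₀/12d²)L^{−d−1}‖CB′‖² ≥ γ′₀‖B′‖²,   (2.157)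
where γ′₀ = (γ₀/12d²)L^{−d−1}. C is a short-ranged operator, so C*Δ_kC has the same exponential decay as Δ_k. Now we
may apply the theory developed in Sect. 5 of [3] on unit lattice operators. It gives us an exponential decay, and all
the other properties, for the operator (C*Δ_kC)^{−1}, hence for C^{(k)}_Λ also. Such a scheme will be applied in the
future to investigate all unit lattice propagators defined by generalizations of the integrals (2.152), (2.154).»
([3] = T. Bałaban, Regularity and decay of lattice Green's functions, Commun. Math. Phys. 89, 571–597 (1983), item 3 of
the reference list on the same page.)

## What this module does ([folklore] fold; NO new mathematics, NO cited Prop as hypothesis)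

Upstream `B6Cov2156TorusSubset.cov2156_torus_subset_deltaPol` proves the exponential decay of the kernel of
C^{(k)}_Λ = C_Λ(C_Λ*Δ_kC_Λ)⁻¹C_Λ* (2.156), for THE matrix `deltaPol M n` of the (1.66) form and every Λ = B(Λ′₀) ⊂
T^(k), under the single residual hypothesis `B6Cov2156Torus.KernelDecay M n c₀ δ₀` («C*Δ_kC has the same exponential
decay as Δ_k» presupposes the decay of Δ_k's kernel).  `B5Kernel166Decay.kernelDecay166` (b05-g9) now PROVES
`∃ c₀ δ₀ > 0, ∀ M n ≥ 1, KernelDecay M n c₀ δ₀`.  The two theorems below substitute the latter into the former (and into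
the every-sub-family version `cov2156_torusS`): the decay of C^{(k)}_Λ for the (1.66) form with NO residual hypothesis,
ONE pair (c, δ) depending on (d, L) only — uniform in the torus T^(k) (all M with L ∣ M_i), in the level n = L^k ≥ 1,
in Λ′₀ and in the sub-family.

HONEST SCOPE.  (i) The constants are the crude ones of the audit construction (`kernelDecay166`: δ₀ = κ₁₆₆(d)/d-type,
c₀ polynomial in d times period constants; then Sect. 5 of [3] on tori, `B6BondEliminationTorus.subReductions_per`),
not Bałaban's.  (ii) «all the other properties» of (C*Δ_kC)^{−1} are NOT enumerated in print and nothing beyond the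
exponential decay of the kernel of C^{(k)}_Λ (and, in `B6Jacobian2155Torus`, (2.155)/(2.157)/Z′) is formalised.
(iii) Gauge group U = 1 componentwise real bond variables, as in the whole B6 lane of this package.  (iv) d ≥ 2, L ≥ 1.
Value = a kernel certificate that the p. 250 paragraph's decay conclusion holds for the concrete (1.66) form on every
Λ = B(Λ′₀) ⊂ T^(k) with no hypothesis left — bookkeeping, NOT summit progress.
-/

open Finset Matrix

namespace Literature.MathematicalPhysics.QuantumFieldTheory.Balaban1983to89.B6Cov2156Subset166

open B6Lemma24Torus (pbox)
open B6BondEliminationTorus (pdist)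
open B6Cov2156Torus (freeT deltaPol deltaPol_isSymm represents_deltaPol KernelDecay one_le_M)
open B6Cov2156TorusSubset (subFamilyT bondReductionLam cov2156_torusS cov2156_torus_subset_deltaPol)
open B5Kernel166Decay (kernelDecay166)

noncomputable section

variable {L : ℕ}

/-- **KERNEL-CHECKED — (2.156)'s decay for EVERY SUB-FAMILY C_S of the torus scheme, (1.66) form, NO residual
hypothesis**: d ≥ 2, L ≥ 1 ⟹ ∃ c, δ > 0 (depending on d, L only) such that for every torus (L ∣ M_i), every level
n ≥ 1 and every sub-family S of the remaining variables, |C_S(C_S*Δ_kC_S)⁻¹C_S*(b,b′)| ≤ c·e^{−δρ_M(b₋,b′₋)} for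
Δ_k = `deltaPol M n` (`cov2156_torusS` ∘ `kernelDecay166`). [cite: Balaban1984PropagatorsII, (2.152)–(2.157)
pp.249–250; Balaban1984PropagatorsI, (1.66) p.29 (locations)] [folklore] -/
theorem cov2156_torusS_166 (d : ℕ) (hd : 2 ≤ d) (hL : 1 ≤ L) :
    ∃ c δ : ℝ, 0 < c ∧ 0 < δ ∧
      ∀ (M : Fin d → ℕ) [∀ μ, NeZero (M μ)], (∀ i, L ∣ M i) → ∀ n : ℕ, 1 ≤ n →
        ∀ (S : Finset (B4.Idx (pbox M) d)) (hS : S ⊆ freeT L M),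
        ∀ p q : B4.Idx (pbox M) d, |(subFamilyT L M S hS (deltaPol M n)).cov p q| ≤
          c * Real.exp (-(δ * pdist M (one_le_M M) (p.1 : Fin d → ℤ) (q.1 : Fin d → ℤ))) := by
  obtain ⟨c₀, δ₀, hc₀, hδ₀, hK⟩ := kernelDecay166 (d := d) (by omega)
  obtain ⟨c, δ, hc, hδ, H⟩ := cov2156_torusS d (L := L) hd hL hc₀ hδ₀
  exact ⟨c, δ, hc, hδ, fun M _ hLM n hn S hS p q =>
    H M hLM n hn (deltaPol M n) (deltaPol_isSymm M n) (represents_deltaPol M n) (hK M n hn) S hS p q⟩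

/-- **KERNEL-CHECKED — THE DECAY OF C^{(k)}_Λ (2.156) ON EVERY Λ = B(Λ′₀) ⊂ T^(k) FOR THE (1.66) FORM, NO RESIDUAL
HYPOTHESIS** («It gives us an exponential decay … for the operator (C*Δ_kC)^{−1}, hence for C^{(k)}_Λ also.»): d ≥ 2,
L ≥ 1 ⟹ ∃ c, δ > 0 (depending on d, L only) such that for every torus (L ∣ M_i), every level n ≥ 1 and every Λ′₀,
|C_Λ(C_Λ*Δ_kC_Λ)⁻¹C_Λ*(b,b′)| ≤ c·e^{−δρ_M(b₋,b′₋)} for Δ_k = `deltaPol M n`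
(`cov2156_torus_subset_deltaPol` ∘ `kernelDecay166`; whole torus: `B5Kernel166Decay.cov2156_torus_166`).
[cite: Balaban1984PropagatorsII, (2.152)–(2.157) pp.249–250; Balaban1984PropagatorsI, (1.66) p.29 (locations)]
[folklore] -/
theorem cov2156_torus_subset_166 (d : ℕ) (hd : 2 ≤ d) (hL : 1 ≤ L) :
    ∃ c δ : ℝ, 0 < c ∧ 0 < δ ∧
      ∀ (M : Fin d → ℕ) [∀ μ, NeZero (M μ)], (∀ i, L ∣ M i) → ∀ n : ℕ, 1 ≤ n →
        ∀ (Λ'₀ : Finset (Fin d → ℤ)) (p q : B4.Idx (pbox M) d),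
          |(bondReductionLam L M Λ'₀ (deltaPol M n)).cov p q| ≤
            c * Real.exp (-(δ * pdist M (one_le_M M) (p.1 : Fin d → ℤ) (q.1 : Fin d → ℤ))) := by
  obtain ⟨c₀, δ₀, hc₀, hδ₀, hK⟩ := kernelDecay166 (d := d) (by omega)
  obtain ⟨c, δ, hc, hδ, H⟩ := cov2156_torus_subset_deltaPol d (L := L) hd hL hc₀ hδ₀
  exact ⟨c, δ, hc, hδ, fun M _ hLM n hn Λ'₀ p q => H M hLM n hn (hK M n hn) Λ'₀ p q⟩

end

end Literature.MathematicalPhysics.QuantumFieldTheory.Balaban1983to89.B6Cov2156Subset166
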